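import Literature.Probability.Percolation.HarrisTheorem
import Literature.Probability.Percolation.ZdNearCriticalWindowProofs
import HarnessLib

/-!
# Blocked annuli (closed dual circuits) of `ℤ²` at a general parameter

Topic `Literature/Probability/Percolation`; proofs only (no definition, no named fact). A
bottom-up layer towards the named fact `Kesten1987_zdKestenRelation`
(`ZdNearCriticalWindow.lean`), companion of `ZdAnnulusCircuitsGeneral.lean` (OPEN circuits in
annuli at a general `p`) for the dual colour: Nolin's basic building block (2008, §3.2, (3.8))
comes with "for symmetry reasons this bound is also valid for horizontal white crossings", and
the white (closed dual) circuits in concentric annuli are what confines black (open) arms. For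
bond percolation on `ℤ²` the tree expresses a closed dual circuit of the square annulus
`{n ≤ ‖z‖_∞ ≤ 3n}` in purely primal form, as the decreasing event `annulusBlocked n`
(`HarrisTheorem.lean`: none of the four `6n × 2n` rectangles of the annulus is crossed the short
way; Bollobás–Riordan 2006, Ch. 3, proof of Thm. 6, event `E_k`), with the deterministic
confinement `openConnIn_box_of_annulusBlocked` ("no point inside `A_k` can be joined to a point
outside `A_k` by an open path") and the Harris–FKG bound
`pow_four_le_real_annulusBlocked p n : (1 - crossingProb p (2n) (6n))⁴ ≤ P_p(annulusBlocked n)`,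
both valid at every `p`. This file feeds the latter with RSW for the DUAL parameter `1 - p`
(duality of crossing probabilities, `crossingProb_add_crossingProb_symm_holds`:
`1 - h_p(2n+1, 6n+1) = h_{1-p}(6n+2, 2n)`):

* `exists_le_real_annulusBlocked_of_le_half` — **for `p ≤ 1/2`, blocked annuli at every scale**:
  there is `c > 0` with `P_p(annulusBlocked n) ≥ c` for all `p ≤ 1/2`, `n ≥ 1` (the dual
  parameter `1 - p ≥ 1/2` enjoys the critical RSW bound, `rsw_lowerBound_of_half_le`);
* `Nolin2008_zdBlocked_below_charLength` — **for `p > 1/2`, blocked annuli below `L_ε(p)`**: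
  `P_p(annulusBlocked n) ≥ (ε⁶/4)^{48}` whenever `2n ≤ L_ε(p)` (the dual parameter `1 - p < 1/2`
  has `L_ε(1-p) = L_ε(p)`, and `Nolin2008_zdRSW_below_charLength` applies to it);
* `real_iInter_compl_annulusBlocked_mul`, `real_boxToFar_le_pow` — independence of the blocked
  annuli along the scales `r·4^(k+1)` and the resulting **geometric decay of the one-arm
  probability in the number of annuli** (Bollobás–Riordan 2006, Ch. 3, proof of Thm. 6, from a
  general inner box `B(r)`), i.e. the a priori one-arm bound of Nolin 2008, Prop. 14 (`j = 1`,
  upper bound, "by using concentric annuli") at a general parameter: for `p ≤ 1/2` at every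
  scale (`exists_real_boxToFar_le_pow_of_le_half`) and for `p > 1/2` below `L_ε(p)`
  (`real_boxToFar_le_pow_of_half_lt`).
-/

noncomputable section

open MeasureTheory Set
open scoped unitInterval

namespace Literature.Probability.Percolation

open LatticeModels

/-- Duality of crossing probabilities in the shape used for blocked annuli:
`1 - crossingProb p (2n) (6n) = crossingProb (1-p) (6n+1) (2n-1)` for `n ≥ 1`
(Bollobás–Riordan 2006, Ch. 3, Cor. 3(i), `crossingProb_add_crossingProb_symm_holds`).
[cite: BollobasRiordan2006, Ch. 3, Corollary 3(i)] -/
theorem one_sub_crossingProb_two_six (p : unitInterval) {n : ℕ} (hn : 1 ≤ n) :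
    1 - crossingProb p (2 * n) (6 * n) = crossingProb (σ p) (6 * n + 1) (2 * n - 1) := by
  have h := crossingProb_add_crossingProb_symm_holds p (2 * n - 1) (6 * n)
  rw [Nat.sub_add_cancel (by omega : 1 ≤ 2 * n)] at h
  linarith

/-- **Blocked annuli at every scale for `p ≤ 1/2`** (Bollobás–Riordan 2006, Ch. 3, proof of
Thm. 6, at a general sub-critical or critical parameter; Nolin 2008, §3.2 (3.8), white
crossings): there is `c > 0` such that `P_p(annulusBlocked n) ≥ c` for all `p ≤ 1/2` and
`n ≥ 1` — the dual edges are open with probability `1 - p ≥ 1/2`, so the long-way dual crossings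
have probability at least the critical RSW constant (`rsw_lowerBound_of_half_le`, `k = 4`), and
Harris–FKG (`pow_four_le_real_annulusBlocked`) assembles the four of them. On this event every
open path from `B(n)` stays inside `(-3n, 3n)²` (`openConnIn_box_of_annulusBlocked`).
[cite: BollobasRiordan2006, Ch. 3, proof of Thm. 6] [cite: Nolin2008, §3.2 (3.8)] -/
theorem exists_le_real_annulusBlocked_of_le_half :
    ∃ c : ℝ, 0 < c ∧ ∀ p : unitInterval, (p : ℝ) ≤ 1 / 2 → ∀ n : ℕ, 1 ≤ n →
      c ≤ (bondPercolation (zdGraph 2) p).real (annulusBlocked n) := by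
  obtain ⟨c, hc, h⟩ := rsw_lowerBound_of_half_le (k := 4) (by norm_num)
  refine ⟨c ^ 4, by positivity, fun p hp n hn => ?_⟩
  have hσ : 1 / 2 ≤ ((σ p : unitInterval) : ℝ) := by rw [unitInterval.coe_symm_eq]; linarith
  have hbox : c ≤ 1 - crossingProb p (2 * n) (6 * n) := by
    rw [one_sub_crossingProb_two_six p hn]
    exact (h (σ p) hσ (2 * n) (by omega)).trans (crossingProb_anti_left _ (by omega) _)
  exact (pow_le_pow_left₀ hc.le hbox 4).trans (pow_four_le_real_annulusBlocked p n)

/-- **Blocked annuli below `L_ε(p)` for `p > 1/2`** (Nolin 2008, §3.2 (3.8), white crossings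
below the characteristic length; Kesten 1987, §2): for `ε ∈ (0, 1/2)`, `p > 1/2` and `n ≥ 1`
with `2n ≤ L_ε(p)`, `P_p(annulusBlocked n) ≥ ((ε⁶/4)^{12})⁴` — the dual parameter `1 - p < 1/2`
has the same characteristic length (`zdCharLength_symm`), its `8n × 2n` boxes below `L_ε` are
crossed the long way with probability `≥ (ε⁶/4)^{12}` (`Nolin2008_zdRSW_below_charLength`,
`k = 4`), and Harris–FKG assembles four of them (`pow_four_le_real_annulusBlocked`).
[cite: Nolin2008, §3.2 (3.8)] [cite: KestenScalingCMP1987, §2] -/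
theorem Nolin2008_zdBlocked_below_charLength {ε : ℝ} (hε : 0 < ε) (hε' : ε < 1 / 2)
    {p : unitInterval} (hp : 1 / 2 < (p : ℝ)) {n : ℕ} (hn : 1 ≤ n) (hnL : 2 * n ≤ zdCharLength ε p) :
    ((ε ^ 6 / 4) ^ (3 * 4)) ^ 4 ≤ (bondPercolation (zdGraph 2) p).real (annulusBlocked n) := by
  have hσ : ((σ p : unitInterval) : ℝ) < 1 / 2 := by rw [unitInterval.coe_symm_eq]; linarith
  have hL : 2 * n ≤ zdCharLength ε (σ p) := by rwa [zdCharLength_symm]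
  have hbox : (ε ^ 6 / 4) ^ (3 * 4) ≤ 1 - crossingProb p (2 * n) (6 * n) := by
    rw [one_sub_crossingProb_two_six p hn]
    exact (Nolin2008_zdRSW_below_charLength hε hε' (k := 4) (by norm_num) hσ (by omega) hL).trans
      (crossingProb_anti_left _ (by omega) _)
  exact (pow_le_pow_left₀ (by positivity) hbox 4).trans (pow_four_le_real_annulusBlocked p n)


/-! ### Disjoint blocked annuli along the scales `r · 4^(k+1)` -/

/-- The events `(annulusBlocked (r·4^(k+1)))ᶜ`, `k < K`, together depend only on the pairs of
sites of `box 2 (3 r 4^K)` (as `determinedBy_iInter_compl_annulusBlocked`, scaled by `r ≥ 1`).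
[folklore] -/
theorem determinedBy_iInter_compl_annulusBlocked_mul {r : ℕ} (hr : 1 ≤ r) (K : ℕ) :
    DeterminedBy (⋂ k ∈ Finset.range K, (annulusBlocked (r * 4 ^ (k + 1)))ᶜ)
      ↑((box 2 (3 * (r * 4 ^ K))).sym2) := by
  induction K with
  | zero => simpa using determinedBy_univ _
  | succ K ih =>
    rw [Finset.range_add_one, Finset.set_biInter_insert]
    have h1 : 1 ≤ r * 4 ^ (K + 1) := Nat.le_mul_of_pos_right _ (by positivity) |>.trans' hr
    refine DeterminedBy.inter ((determinedBy_compl_annulusBlocked h1).mono ?_) (ih.mono ?_)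
    · exact Finset.coe_subset.2 (Finset.sym2_mono fun z hz => (mem_annulus.1 hz).1)
    · refine Finset.coe_subset.2 (Finset.sym2_mono (box_mono 2 ?_))
      have : 4 ^ K ≤ 4 ^ (K + 1) := Nat.pow_le_pow_right (by norm_num) (Nat.le_succ K)
      nlinarith

/-- Measurability of the same intersection. [folklore] -/
theorem measurableSet_iInter_compl_annulusBlocked_mul (r K : ℕ) :
    MeasurableSet (⋂ k ∈ Finset.range K, (annulusBlocked (r * 4 ^ (k + 1)))ᶜ) :=
  Finset.measurableSet_biInter _ fun _ _ => (measurableSet_annulusBlocked _).compl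

/-- **Independence of disjoint annuli, scaled** (Bollobás–Riordan 2006, Ch. 3, proof of Thm. 6:
"As the `A_k` are disjoint, the events `E_k` are independent"; as
`real_iInter_compl_annulusBlocked` with the scales `r · 4^(k+1)`, `r ≥ 1`): for every `p`,
`P_p(⋂_{k<K} (annulusBlocked (r 4^(k+1)))ᶜ) = ∏_{k<K} (1 - P_p(annulusBlocked (r 4^(k+1))))`.
[cite: BollobasRiordan2006, Ch. 3, proof of Thm. 6] -/
theorem real_iInter_compl_annulusBlocked_mul (p : unitInterval) {r : ℕ} (hr : 1 ≤ r) (K : ℕ) :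
    (bondPercolation (zdGraph 2) p).real (⋂ k ∈ Finset.range K, (annulusBlocked (r * 4 ^ (k + 1)))ᶜ) =
      ∏ k ∈ Finset.range K,
        (1 - (bondPercolation (zdGraph 2) p).real (annulusBlocked (r * 4 ^ (k + 1)))) := by
  induction K with
  | zero => simp
  | succ K ih =>
    rw [Finset.prod_range_succ, Finset.range_add_one, Finset.set_biInter_insert, ← ih,
      ← probReal_compl_eq_one_sub (measurableSet_annulusBlocked _), Set.inter_comm]
    have hlt : 3 * (r * 4 ^ K) < r * 4 ^ (K + 1) := by
      rw [pow_succ]; have := Nat.one_le_pow K 4 (by norm_num); nlinarith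
    have h1 : 1 ≤ r * 4 ^ (K + 1) := Nat.le_mul_of_pos_right _ (by positivity) |>.trans' hr
    exact bondPercolation_real_inter_of_disjoint (zdGraph 2) p (disjoint_sym2_box_sym2_annulus hlt)
      (determinedBy_iInter_compl_annulusBlocked_mul hr K) (determinedBy_compl_annulusBlocked h1)
      (measurableSet_iInter_compl_annulusBlocked_mul r K) (measurableSet_annulusBlocked _).compl

/-! ### The one-arm event crosses every annulus in between -/

/-- **An open path from `B(r)` to the outside of `B(R)` crosses the `K` annuli
`{r4^(k+1) ≤ ‖z‖_∞ ≤ 3r4^(k+1)}`, `k < K`, as soon as `3 r 4^K ≤ R + 1`**, so none of them is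
blocked (`openConnIn_box_of_annulusBlocked`; lattice configurations). [cite: BollobasRiordan2006, Ch. 3, proof of Thm. 6] -/
theorem mem_iInter_compl_annulusBlocked_of_openConnIn {ω : BondConfig (Site 2)}
    (hω : ω ⊆ (zdGraph 2).edgeSet) {r R K : ℕ} (hr : 1 ≤ r) (hK : 3 * (r * 4 ^ K) ≤ R + 1)
    {x y : Site 2} (hx : x ∈ box 2 r) (hy : y ∉ box 2 R) (h : ω ∈ openConnIn Set.univ x y) :
    ω ∈ ⋂ k ∈ Finset.range K, (annulusBlocked (r * 4 ^ (k + 1)))ᶜ := by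
  simp only [Set.mem_iInter, Set.mem_compl_iff, Finset.mem_range]
  intro k hk hB
  have h1s : 1 ≤ r * 4 ^ (k + 1) := Nat.le_mul_of_pos_right _ (by positivity) |>.trans' hr
  have hrs : r ≤ r * 4 ^ (k + 1) := Nat.le_mul_of_pos_right _ (by positivity)
  have hsK : 3 * (r * 4 ^ (k + 1)) ≤ R + 1 := by
    have : 4 ^ (k + 1) ≤ 4 ^ K := Nat.pow_le_pow_right (by norm_num) hk
    have : r * 4 ^ (k + 1) ≤ r * 4 ^ K := Nat.mul_le_mul_left r this
    omega
  have hconf := openConnIn_box_of_annulusBlocked hω h1s hB (box_mono 2 hrs hx) h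
  rw [mem_box, not_forall] at hy
  obtain ⟨i, hi⟩ := hy
  have := hconf i
  zify at hsK
  push_cast at this hsK hi
  omega

/-- **The one-arm probability decays geometrically in the number of free annuli** (Bollobás–Riordan
2006, Ch. 3, proof of Thm. 6: `P_{1/2}(r(C_0) ≥ 4^{ℓ+1}) ≤ (1 - ε)^ℓ`, at a general parameter and
from a general inner box): if `P_p(annulusBlocked (r 4^(k+1))) ≥ c` for all `k < K` and
`3 r 4^K ≤ R + 1`, then the probability that some site of `B(r)` is joined by an open path to
some site outside `B(R)` is at most `(1 - c)^K`. [cite: BollobasRiordan2006, Ch. 3, proof of Thm. 6] -/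
theorem real_boxToFar_le_pow (p : unitInterval) {r R K : ℕ} (hr : 1 ≤ r) (hK : 3 * (r * 4 ^ K) ≤ R + 1)
    {c : ℝ} (hc : ∀ k < K, c ≤ (bondPercolation (zdGraph 2) p).real (annulusBlocked (r * 4 ^ (k + 1)))) :
    (bondPercolation (zdGraph 2) p).real
        {ω | ∃ x ∈ box 2 r, ∃ y ∉ box 2 R, ω ∈ openConnIn Set.univ x y} ≤ (1 - c) ^ K := by
  set μ := bondPercolation (zdGraph 2) p with hμ
  calc μ.real {ω | ∃ x ∈ box 2 r, ∃ y ∉ box 2 R, ω ∈ openConnIn Set.univ x y}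
      ≤ μ.real (⋂ k ∈ Finset.range K, (annulusBlocked (r * 4 ^ (k + 1)))ᶜ) := by
        refine ENNReal.toReal_mono (measure_ne_top _ _) (measure_mono_ae ?_)
        filter_upwards [ae_subset_edgeSet (zdGraph 2) p] with ω hω harm
        obtain ⟨x, hx, y, hy, h⟩ := harm
        exact mem_iInter_compl_annulusBlocked_of_openConnIn hω hr hK hx hy h
    _ = ∏ k ∈ Finset.range K, (1 - μ.real (annulusBlocked (r * 4 ^ (k + 1)))) :=
        real_iInter_compl_annulusBlocked_mul p hr K
    _ ≤ ∏ _k ∈ Finset.range K, (1 - c) :=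
        Finset.prod_le_prod (fun _ _ => sub_nonneg.2 measureReal_le_one)
          (fun k hk => by linarith [hc k (Finset.mem_range.1 hk)])
    _ = (1 - c) ^ K := by rw [Finset.prod_const, Finset.card_range]

/-- **A priori one-arm bound for `p ≤ 1/2`, every scale** (Nolin 2008, Prop. 13 upper bound for
`j = 1` [EJP: Prop. 14], "obtained by using concentric annuli", at a sub-critical or critical
parameter; Bollobás–Riordan 2006, Ch. 3, proof of Thm. 6): with the constant `c` of
`exists_le_real_annulusBlocked_of_le_half`, for all `p ≤ 1/2`, `r ≥ 1`, `K` and `R` with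
`3 r 4^K ≤ R + 1`, `P_p(B(r) ↔ B(R)ᶜ) ≤ (1 - c)^K`. [cite: Nolin2008, §4.2, Prop. 14 (arXiv 0711.4948: Prop. 13)] [cite: BollobasRiordan2006, Ch. 3, proof of Thm. 6] -/
theorem exists_real_boxToFar_le_pow_of_le_half :
    ∃ c : ℝ, 0 < c ∧ ∀ p : unitInterval, (p : ℝ) ≤ 1 / 2 → ∀ r R K : ℕ, 1 ≤ r →
      3 * (r * 4 ^ K) ≤ R + 1 →
        (bondPercolation (zdGraph 2) p).real
          {ω | ∃ x ∈ box 2 r, ∃ y ∉ box 2 R, ω ∈ openConnIn Set.univ x y} ≤ (1 - c) ^ K := by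
  obtain ⟨c, hc, h⟩ := exists_le_real_annulusBlocked_of_le_half
  exact ⟨c, hc, fun p hp r R K hr hK => real_boxToFar_le_pow p hr hK fun k _ =>
    h p hp _ (Nat.le_mul_of_pos_right _ (by positivity) |>.trans' hr)⟩

/-- **A priori one-arm bound for `p > 1/2` below `L_ε(p)`** (Nolin 2008, Prop. 13 upper bound for
`j = 1` [EJP: Prop. 14], uniformly for the scales below the characteristic length): for
`ε ∈ (0, 1/2)`, `p > 1/2`, `r ≥ 1` and `K` with `2 r 4^K ≤ L_ε(p)`, and `3 r 4^K ≤ R + 1`,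
`P_p(B(r) ↔ B(R)ᶜ) ≤ (1 - (ε⁶/4)^{48})^K` (`Nolin2008_zdBlocked_below_charLength` in every annulus).
[cite: Nolin2008, §4.2, Prop. 14 (arXiv 0711.4948: Prop. 13)] -/
theorem real_boxToFar_le_pow_of_half_lt {ε : ℝ} (hε : 0 < ε) (hε' : ε < 1 / 2)
    {p : unitInterval} (hp : 1 / 2 < (p : ℝ)) {r R K : ℕ} (hr : 1 ≤ r)
    (hKL : 2 * (r * 4 ^ K) ≤ zdCharLength ε p) (hK : 3 * (r * 4 ^ K) ≤ R + 1) :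
    (bondPercolation (zdGraph 2) p).real
        {ω | ∃ x ∈ box 2 r, ∃ y ∉ box 2 R, ω ∈ openConnIn Set.univ x y} ≤
      (1 - ((ε ^ 6 / 4) ^ (3 * 4)) ^ 4) ^ K := by
  refine real_boxToFar_le_pow p hr hK fun k hk => ?_
  have h1 : 1 ≤ r * 4 ^ (k + 1) := Nat.le_mul_of_pos_right _ (by positivity) |>.trans' hr
  refine Nolin2008_zdBlocked_below_charLength hε hε' hp h1 (le_trans ?_ hKL)
  have : 4 ^ (k + 1) ≤ 4 ^ K := Nat.pow_le_pow_right (by norm_num) hk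
  nlinarith

end Literature.Probability.Percolation
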